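/-
Origin: expansion seat `prover-pub-hodgecm-mc-binder-2-g10-0`, handover #25 23:11Z md5 38a0e67e1e85 (314 l.; imports PKG `HodgeCM.PerL34.TorusUnitaryEmbedding`, `HodgeCM.PerL34.SeesawTorus`, `HodgeCM.Automorphic.AdelicTorusThetaData` + twins `…Automorphic.UnitaryGroupArchimedean`, `…GelbartRogawski1991.UnitaryDualPairThetaKernelCM` — ALL RUN-36 INSTALLED; (J-T12)/(J-T34) adelic halves of the chart junction: §1 `archUnit`, `archDiagGL`, `archDiagGL_mem_arch`, `archDiag`, `archDiagHom`, `map_fst/snd_toGL_toAdeles`, `ofInfinite_archDiagGL`, `cmAdelicEquiv_jT_toAdeles`; §2 `archGL`, `conjMixed_mixedEmbedding`, `map_fst_toAdeleGL`, **`conj_mem_arch_of_congr`** (ᵗḡJg = J′ ∧ x ∈ arch J′ ⇒ g x g⁻¹ ∈ arch J), `archConjDiag`, `toAdeleGL_mul_toGL_mul_inv`; §3 at a seesaw datum: **`cmAdelicEquiv_jT₃₄_toAdeles`** (`cmAdelicEquiv L 2 D.gramW (D.jT₃₄ (toAdeles u)) = archToAdelic … (archConjDiag L D.isoGL ![a₀,a₁]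 ![a₂,a₃] D.isoGL_spec u)`), **`cmAdelicEquiv_jT₁₂_toAdeles`** (`= archToAdelic … (archDiag L ![a₀,a₁] u)`) — E's chart points ARE archimedean pair elements, so `SmoothTheta.cmPairRepTwist_archProdHom_tmul` applies to `omg_ins`) (`HOME/mc/pub-hodgecm-mc-binder-2/g10/pkg/HodgeCM/Model/HypCensus/TorusChart.lean`, md5 38a0e67e, 314 lines);
landed by the gen-13 packager (p-g13) in gate run 37 as `HodgeCM/Model/HypCensus/TorusChart.lean` (verbatim).
-/
/-
Origin: speedrun cell pub-hodgecm, MODEL-CONSTRUCTION sub-cell, lineage mc-binder-2 (BINDER-OWNERS rows 18/19: E binders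
`hyp12` / `hyp34` of `Model.perL_picardCM_r15A`), seat prover-pub-hodgecm-mc-binder-2-g8-0 (gen 8), 2026-08-19.
Target in PKG: `HodgeCM/Model/HypCensus/TorusChart.lean` (NEW additive leaf; imports PKG `PerL34/TorusUnitaryEmbedding`,
`PerL34/SeesawTorus` (RUN 26/25) and the twins `Automorphic/UnitaryGroupArchimedean` (RUN 35),
`GelbartRogawski1991/UnitaryDualPairThetaKernelCM` (RUN 35/36); nothing landed imports it).  KERNEL ONLY: 0 records,
nothing cited, 0 `def … : Prop`, 2 data defs + `rfl`/matrix lemmas.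
-/
import Summits.HodgeConjecture.HodgeCM.PerL34.TorusUnitaryEmbedding
import Summits.HodgeConjecture.HodgeCM.PerL34.SeesawTorus_3
import Summits.HodgeConjecture.HodgeCM.Automorphic.AdelicTorusThetaData_2
import Literature.NumberTheory.Automorphic.UnitaryGroupArchimedean
import Literature.NumberTheory.GelbartRogawski1991.UnitaryDualPairThetaKernelCM

/-!
# Census kit (rows A12/A34), junction (J-T12)/(J-T34), adelic half: the printed torus point IS an archimedean element

E's (12) chart sends a printed torus point `t ∈ T_print(L₀ ⊗ ℝ)` to `jT₁₂ (ιc u) ∈ U(W)(𝔸)`, `u = (placesEquiv L)⁻¹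
(placesCoord t) ∈ T(L₀ ⊗ ℝ) = U(W₁)(L₀ ⊗ ℝ) × U(W₂)(L₀ ⊗ ℝ)` (pv11 `printedTorusHom`, pv07 `toAdeles`), and the `wm` input
of record reads `U(W)(𝔸)` through `eW := cmAdelicEquiv L 2 (diagonal (dW S))` (mc-unitary-1 `wmInputCM₂`).  The census's
archimedean dictionaries (`HypCensus/TorusBlock`, `KappaEigen`, `…Dictionary`) act on elements of the form
`archProdHom (x_∞, y_∞) = ((x_∞, 1), (y_∞, 1))` (binder-2-g6 `ArchFactor`), `y_∞ ∈ U(J_W)(L⁺ ⊗ ℝ) = UnitaryGroup.arch …`.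
This leaf identifies the two:

* `archUnit y` — an archimedean unit `y ∈ L_∞ˣ` read in `(L ⊗ ℝ)ˣ = (mixedSpace L)ˣ` (Mathlib's `ringEquiv_mixedSpace`);
* **`archDiagGL u = diag(u₁, u₂) ∈ GL₂(L ⊗ ℝ)`** and **`archDiag h u ∈ U(diag h)(L⁺ ⊗ ℝ)`** (`archDiagGL_mem_arch`: norm-one
  units are unitary for every diagonal form — PKG `DiagonalTorus.diagGL₂_unitary_of_mul_conj_eq_one` over `mixedSpace L` with
  the conjugation `conjMixed`);
* **`ofInfinite_archDiagGL : GLn.ofInfinite 2 L (archDiagGL u) = toGL L (toAdeles L u)`** — `(diag(u₁,u₂), 1) = diag((u₁,1),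
  (u₂,1))` in `GL₂(𝔸_L)` (archimedean / finite parts, `matrix_adele_ext`);
* **`cmAdelicEquiv_jT_toAdeles : cmAdelicEquiv L 2 (diagonal h) (jT L h (toAdeles L u)) = archToAdelic … (archDiag h u)`**
  — the (J-T) identity: on the `wm` input of record, E's chart point is the adelic image of an ARCHIMEDEAN pair element
  `(1, archDiag h u)`, so `ρ(1, eW (jT₁₂ (ιc u))) = ρ(archProdHom (1, archDiag h u))` and the census's `ω_∞` factorisation
  (`cmPairRepTwist_archProdHom_tmul`) applies.  (For `jT₃₄ = g (·) g⁻¹` the same with the rational isometry `g = D.isoGL`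
  conjugating `archDiag`; successor.)

Nothing here is a claim of PerL/QW8.  [BorelJacquet1979, §4.1; Mok2014, §1] is the provenance of the tree notions used.
-/

set_option autoImplicit false

noncomputable section

open Matrix NumberField NumberField.InfinitePlace
open HodgeCM.PerL34.DiagonalTorus HodgeCM.PerL34.TorusEmbedding HodgeCM.Adelic
open Literature.NumberTheory.Automorphic Literature.NumberTheory.Automorphic.UnitaryGroup
open Literature.NumberTheory.GelbartRogawski1991 Literature.NumberTheory.GelbartRogawski1991.UnitaryDualPair

namespace HodgeCM.Model.HypCensus

section ArchTorus

variable (L : Type) [Field L] [NumberField L] [IsCMField L]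

/-- an archimedean unit `y ∈ L_∞ˣ` read in `(L ⊗_ℚ ℝ)ˣ = (mixedSpace L)ˣ`. -/
def archUnit : (InfiniteAdeleRing L)ˣ →* (mixedEmbedding.mixedSpace L)ˣ :=
  Units.map (InfiniteAdeleRing.ringEquiv_mixedSpace L).toRingHom.toMonoidHom

omit [NumberField L] [IsCMField L] in
/-- (Ported verbatim from the HodgeCMPerL package; no docstring in the source.) -/
@[simp] theorem coe_archUnit (y : (InfiniteAdeleRing L)ˣ) :
    ((archUnit L y : (mixedEmbedding.mixedSpace L)ˣ) : mixedEmbedding.mixedSpace L) =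
      InfiniteAdeleRing.ringEquiv_mixedSpace L (y : InfiniteAdeleRing L) := rfl

/-- a norm-one archimedean unit satisfies `y · ȳ = 1` in `L ⊗ ℝ` (conjugation `conjMixed`). -/
theorem coe_archUnit_mul_conjMixed (y : ↥(unitaryLineArchTorus L)) :
    ((archUnit L (y : (InfiniteAdeleRing L)ˣ) : (mixedEmbedding.mixedSpace L)ˣ) : mixedEmbedding.mixedSpace L) *
        conjMixed (↥(maximalRealSubfield L)) L (IsCMField.complexConj L)
          ((archUnit L (y : (InfiniteAdeleRing L)ˣ) : (mixedEmbedding.mixedSpace L)ˣ) : mixedEmbedding.mixedSpace L) = 1 := by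
  have hy := (mem_relNormOneInfUnits_iff_mul_conj (L := L) (y : (InfiniteAdeleRing L)ˣ)).1 y.2
  have hy' := congrArg (fun z : (InfiniteAdeleRing L)ˣ => (z : InfiniteAdeleRing L)) hy
  simp only [Units.val_mul, InfiniteAdeleRing.coe_smul_units, Units.val_one] at hy'
  rw [coe_archUnit, conjMixed_ringEquiv, ← map_mul, hy', map_one]

/-- **`diag(u₁, u₂) ∈ GL₂(L ⊗ ℝ)`** for `u = (u₁, u₂) ∈ T(L₀ ⊗ ℝ) = U(W₁)(L₀ ⊗ ℝ) × U(W₂)(L₀ ⊗ ℝ)`. -/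
def archDiagGL (u : SeesawArchTorus L) : GL (Fin 2) (mixedEmbedding.mixedSpace L) :=
  diagGL₂ (archUnit L ((SeesawArchTorus.fst L u : ↥(unitaryLineArchTorus L)) : (InfiniteAdeleRing L)ˣ),
    archUnit L ((SeesawArchTorus.snd L u : ↥(unitaryLineArchTorus L)) : (InfiniteAdeleRing L)ˣ))

/-- (Ported verbatim from the HodgeCMPerL package; no docstring in the source.) -/
theorem val_archDiagGL (u : SeesawArchTorus L) :
    ((archDiagGL L u : GL (Fin 2) (mixedEmbedding.mixedSpace L)) : Matrix (Fin 2) (Fin 2) (mixedEmbedding.mixedSpace L)) =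
      diagonal ![InfiniteAdeleRing.ringEquiv_mixedSpace L
          (((SeesawArchTorus.fst L u : ↥(unitaryLineArchTorus L)) : (InfiniteAdeleRing L)ˣ) : InfiniteAdeleRing L),
        InfiniteAdeleRing.ringEquiv_mixedSpace L
          (((SeesawArchTorus.snd L u : ↥(unitaryLineArchTorus L)) : (InfiniteAdeleRing L)ˣ) : InfiniteAdeleRing L)] := by
  rw [archDiagGL, val_diagGL₂]
  rfl

/-- **`diag(u₁, u₂) ∈ U(diag h)(L⁺ ⊗ ℝ)` for every diagonal form `h`** (norm-one units are unitary). -/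
theorem archDiagGL_mem_arch (h : Fin 2 → L) (u : SeesawArchTorus L) :
    archDiagGL L u ∈ UnitaryGroup.arch (↥(maximalRealSubfield L)) L (IsCMField.complexConj L) 2 (diagonal h) := by
  rw [mem_arch_iff, archFormOf, diagonal_map (map_zero _), archDiagGL]
  exact diagGL₂_unitary_of_mul_conj_eq_one (conjMixed (↥(maximalRealSubfield L)) L (IsCMField.complexConj L)) _ _
    (coe_archUnit_mul_conjMixed L _) (coe_archUnit_mul_conjMixed L _)

/-- **the archimedean torus element `diag(u₁, u₂) ∈ U(diag h)(L⁺ ⊗ ℝ)`**. -/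
def archDiag (h : Fin 2 → L) (u : SeesawArchTorus L) :
    ↥(UnitaryGroup.arch (↥(maximalRealSubfield L)) L (IsCMField.complexConj L) 2 (diagonal h)) :=
  ⟨archDiagGL L u, archDiagGL_mem_arch L h u⟩

/-- (Ported verbatim from the HodgeCMPerL package; no docstring in the source.) -/
@[simp] theorem coe_archDiag (h : Fin 2 → L) (u : SeesawArchTorus L) :
    ((archDiag L h u : ↥(UnitaryGroup.arch (↥(maximalRealSubfield L)) L (IsCMField.complexConj L) 2 (diagonal h))) :
      GL (Fin 2) (mixedEmbedding.mixedSpace L)) = archDiagGL L u := rfl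

/-- `archDiag h` is a monoid hom `T(L₀ ⊗ ℝ) →* U(diag h)(L⁺ ⊗ ℝ)`. -/
def archDiagHom (h : Fin 2 → L) :
    SeesawArchTorus L →* ↥(UnitaryGroup.arch (↥(maximalRealSubfield L)) L (IsCMField.complexConj L) 2 (diagonal h)) where
  toFun := archDiag L h
  map_one' := Subtype.ext (by
    change archDiagGL L 1 = 1
    simp only [archDiagGL, map_one, OneMemClass.coe_one, Prod.mk_one_one])
  map_mul' u u' := Subtype.ext (by
    change archDiagGL L (u * u') = archDiagGL L u * archDiagGL L u'
    simp only [archDiagGL, map_mul, Subgroup.coe_mul]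
    rw [← map_mul diagGL₂, Prod.mk_mul_mk])

/-- (Ported verbatim from the HodgeCMPerL package; no docstring in the source.) -/
@[simp] theorem archDiagHom_apply (h : Fin 2 → L) (u : SeesawArchTorus L) : archDiagHom L h u = archDiag L h u := rfl

/-- the archimedean part of `toGL (ιc u)` is `diag(u₁, u₂)`. -/
theorem map_fst_toGL_toAdeles (u : SeesawArchTorus L) :
    ((toGL L (SeesawArchTorus.toAdeles L u) : GL (Fin 2) (AdeleRing (𝓞 L) L)) :
        Matrix (Fin 2) (Fin 2) (AdeleRing (𝓞 L) L)).map (adeleFst L) =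
      diagonal ![(((SeesawArchTorus.fst L u : ↥(unitaryLineArchTorus L)) : (InfiniteAdeleRing L)ˣ) : InfiniteAdeleRing L),
        (((SeesawArchTorus.snd L u : ↥(unitaryLineArchTorus L)) : (InfiniteAdeleRing L)ˣ) : InfiniteAdeleRing L)] := by
  rw [val_toGL, diagonal_map (map_zero _)]
  congr 1
  funext i
  fin_cases i <;> rfl

/-- the finite part of `toGL (ιc u)` is `1`. -/
theorem map_snd_toGL_toAdeles (u : SeesawArchTorus L) :
    ((toGL L (SeesawArchTorus.toAdeles L u) : GL (Fin 2) (AdeleRing (𝓞 L) L)) :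
        Matrix (Fin 2) (Fin 2) (AdeleRing (𝓞 L) L)).map (adeleSnd L) = 1 := by
  rw [val_toGL, diagonal_map (map_zero _)]
  rw [show (fun m : Fin 2 => adeleSnd L
      (![(((SeesawTorus.fst (↥(maximalRealSubfield L)) L (SeesawArchTorus.toAdeles L u) :
          ↥(relNormOneIdeles (↥(maximalRealSubfield L)) L)) : ideleGroup L) : AdeleRing (𝓞 L) L),
        (((SeesawTorus.snd (↥(maximalRealSubfield L)) L (SeesawArchTorus.toAdeles L u) :
          ↥(relNormOneIdeles (↥(maximalRealSubfield L)) L)) : ideleGroup L) : AdeleRing (𝓞 L) L)] m)) =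
      fun _ => 1 from by funext i; fin_cases i <;> rfl]
  exact diagonal_one

/-- the archimedean part of `(diag(u₁,u₂), 1)` is `diag(u₁, u₂)`. -/
theorem map_ringEquiv_symm_archDiagGL (u : SeesawArchTorus L) :
    ((archDiagGL L u : GL (Fin 2) (mixedEmbedding.mixedSpace L)) : Matrix (Fin 2) (Fin 2) (mixedEmbedding.mixedSpace L)).map
        (InfiniteAdeleRing.ringEquiv_mixedSpace L).symm.toRingHom =
      diagonal ![(((SeesawArchTorus.fst L u : ↥(unitaryLineArchTorus L)) : (InfiniteAdeleRing L)ˣ) : InfiniteAdeleRing L),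
        (((SeesawArchTorus.snd L u : ↥(unitaryLineArchTorus L)) : (InfiniteAdeleRing L)ˣ) : InfiniteAdeleRing L)] := by
  rw [val_archDiagGL, diagonal_map (map_zero _)]
  congr 1
  funext i
  fin_cases i
  · change (InfiniteAdeleRing.ringEquiv_mixedSpace L).symm (InfiniteAdeleRing.ringEquiv_mixedSpace L _) = _
    rw [RingEquiv.symm_apply_apply]
    rfl
  · change (InfiniteAdeleRing.ringEquiv_mixedSpace L).symm (InfiniteAdeleRing.ringEquiv_mixedSpace L _) = _
    rw [RingEquiv.symm_apply_apply]
    rfl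

/-- **`(diag(u₁, u₂), 1) = diag((u₁, 1), (u₂, 1))` in `GL₂(𝔸_L)`**: the archimedean embedding of the diagonal torus element
IS pv06's `toGL` of the archimedean-component idele pair. -/
theorem ofInfinite_archDiagGL (u : SeesawArchTorus L) :
    GLn.ofInfinite 2 L (archDiagGL L u) = toGL L (SeesawArchTorus.toAdeles L u) := by
  apply Units.ext
  refine matrix_adele_ext L 2 ?_ ?_
  · rw [map_fst_ofInfinite, map_ringEquiv_symm_archDiagGL, map_fst_toGL_toAdeles]
  · rw [map_snd_ofInfinite, map_snd_toGL_toAdeles]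

/-- **(J-T), adelic half: E's chart point is the adelic image of the ARCHIMEDEAN torus element.**  On the `wm` input of
record (`eW := cmAdelicEquiv L 2 (diagonal (dW S))`): `eW (jT₁₂ (ιc u)) = archToAdelic (archDiag (dW S) u)`, hence
`(1, eW (jT₁₂ (ιc u))) = archProdHom (1, archDiag (dW S) u)`. -/
theorem cmAdelicEquiv_jT_toAdeles (h : Fin 2 → L) (u : SeesawArchTorus L) :
    cmAdelicEquiv L 2 (diagonal h) (jT L h (SeesawArchTorus.toAdeles L u)) =
      archToAdelic (↥(maximalRealSubfield L)) L (IsCMField.complexConj L) 2 (diagonal h) (archDiag L h u) := by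
  apply Subtype.ext
  change ((jT L h (SeesawArchTorus.toAdeles L u) : ↥(HodgeCM.Adelic.adelicUnitaryGroup L (diagonal h))) :
      GL (Fin 2) (AdeleRing (𝓞 L) L)) =
    GLn.ofInfinite 2 L (archDiagGL L u)
  rw [coe_jT, ofInfinite_archDiagGL]

/-! ## §2 The (34) torus: conjugation by the rational isometry `g = D.isoGL` -/

/-- a rational matrix `g ∈ GL₂(L)` read in `GL₂(L ⊗ ℝ)`. -/
def archGL : GL (Fin 2) L →* GL (Fin 2) (mixedEmbedding.mixedSpace L) :=
  Units.map (mixedEmbedding L).mapMatrix.toMonoidHom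

omit [NumberField L] [IsCMField L] in
/-- (Ported verbatim from the HodgeCMPerL package; no docstring in the source.) -/
@[simp] theorem val_archGL (g : GL (Fin 2) L) :
    ((archGL L g : GL (Fin 2) (mixedEmbedding.mixedSpace L)) : Matrix (Fin 2) (Fin 2) (mixedEmbedding.mixedSpace L)) =
      (g : Matrix (Fin 2) (Fin 2) L).map (mixedEmbedding L) := rfl

/-- `c ⊗ 1` on `L ⊗ ℝ` extends complex conjugation of `L`. -/
theorem conjMixed_mixedEmbedding (a : L) :
    conjMixed (↥(maximalRealSubfield L)) L (IsCMField.complexConj L) (mixedEmbedding L a) =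
      mixedEmbedding L (IsCMField.complexConj L a) := by
  rw [InfiniteAdeleRing.mixedEmbedding_eq_algebraMap_comp, conjMixed_ringEquiv, InfiniteAdeleRing.smul_algebraMap,
    ← InfiniteAdeleRing.mixedEmbedding_eq_algebraMap_comp]

/-- (Ported verbatim from the HodgeCMPerL package; no docstring in the source.) -/
theorem map_conjMixed_map_mixedEmbedding (g : Matrix (Fin 2) (Fin 2) L) :
    (g.map (mixedEmbedding L)).map (conjMixed (↥(maximalRealSubfield L)) L (IsCMField.complexConj L)) =
      (g.map (Literature.AlgebraicGeometry.ShimuraVarieties.conjRingHomK L)).map (mixedEmbedding L) := by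
  rw [Matrix.map_map, Matrix.map_map]
  congr 1
  funext a
  exact conjMixed_mixedEmbedding L a

omit [IsCMField L] in
/-- the archimedean part of `g_𝔸` is `g ⊗ 1`. -/
theorem map_fst_toAdeleGL (g : GL (Fin 2) L) :
    ((Adelic.toAdeleGL L g : GL (Fin 2) (AdeleRing (𝓞 L) L)) : Matrix (Fin 2) (Fin 2) (AdeleRing (𝓞 L) L)).map (adeleFst L) =
      ((archGL L g : GL (Fin 2) (mixedEmbedding.mixedSpace L)) : Matrix (Fin 2) (Fin 2) (mixedEmbedding.mixedSpace L)).map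
        (InfiniteAdeleRing.ringEquiv_mixedSpace L).symm.toRingHom := by
  rw [Adelic.val_toAdeleGL, val_archGL, Matrix.map_map, Matrix.map_map]
  congr 1
  funext a
  change (algebraMap L (AdeleRing (𝓞 L) L) a).1 = (InfiniteAdeleRing.ringEquiv_mixedSpace L).symm (mixedEmbedding L a)
  rw [InfiniteAdeleRing.mixedEmbedding_eq_algebraMap_comp, RingEquiv.symm_apply_apply]
  rfl

/-- **Conjugation by a rational isometry transports archimedean unitary groups**: if `ᵗḡ J g = J'` and `x ∈ U(J')(L⁺ ⊗ ℝ)`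
then `g x g⁻¹ ∈ U(J)(L⁺ ⊗ ℝ)`. -/
theorem conj_mem_arch_of_congr (g : GL (Fin 2) L) (J J' : Matrix (Fin 2) (Fin 2) L)
    (hg : ((g : Matrix (Fin 2) (Fin 2) L).map (Literature.AlgebraicGeometry.ShimuraVarieties.conjRingHomK L))ᵀ * J * (g : Matrix (Fin 2) (Fin 2) L) = J')
    {x : GL (Fin 2) (mixedEmbedding.mixedSpace L)}
    (hx : x ∈ UnitaryGroup.arch (↥(maximalRealSubfield L)) L (IsCMField.complexConj L) 2 J') :
    archGL L g * x * (archGL L g)⁻¹ ∈ UnitaryGroup.arch (↥(maximalRealSubfield L)) L (IsCMField.complexConj L) 2 J := by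
  rw [mem_arch_iff, archFormOf] at hx ⊢
  set m := mixedEmbedding L with hm
  set cM := conjMixed (↥(maximalRealSubfield L)) L (IsCMField.complexConj L) with hcM
  set G : Matrix (Fin 2) (Fin 2) (mixedEmbedding.mixedSpace L) := (g : Matrix (Fin 2) (Fin 2) L).map m with hG
  set Gi : Matrix (Fin 2) (Fin 2) (mixedEmbedding.mixedSpace L) := ((g⁻¹ : GL (Fin 2) L) : Matrix (Fin 2) (Fin 2) L).map m
    with hGi
  set X : Matrix (Fin 2) (Fin 2) (mixedEmbedding.mixedSpace L) := (x : Matrix (Fin 2) (Fin 2) (mixedEmbedding.mixedSpace L))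
    with hX
  have hGGi : G * Gi = 1 := by
    rw [hG, hGi, ← Matrix.map_mul, ← Units.val_mul, mul_inv_cancel, Units.val_one, Matrix.map_one _ (map_zero m) (map_one m)]
  have hGiG : Gi * G = 1 := by
    rw [hG, hGi, ← Matrix.map_mul, ← Units.val_mul, inv_mul_cancel, Units.val_one, Matrix.map_one _ (map_zero m) (map_one m)]
  -- the congruence read in `L ⊗ ℝ`: `(Ḡ)ᵀ (J ⊗ 1) G = J' ⊗ 1`
  have hcong : (G.map cM)ᵀ * J.map m * G = J'.map m := by
    rw [hG, hcM, hm, map_conjMixed_map_mixedEmbedding, ← hg, Matrix.map_mul, Matrix.map_mul, Matrix.transpose_map]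
  -- and inverted: `(Ḡi)ᵀ (J' ⊗ 1) Gi = J ⊗ 1`
  have hcong' : (Gi.map cM)ᵀ * J'.map m * Gi = J.map m := by
    have h1 : (G.map cM) * (Gi.map cM) = 1 := by
      rw [← Matrix.map_mul, hGGi, Matrix.map_one _ (map_zero cM) (map_one cM)]
    calc (Gi.map cM)ᵀ * J'.map m * Gi = (Gi.map cM)ᵀ * ((G.map cM)ᵀ * J.map m * G) * Gi := by rw [hcong]
      _ = ((G.map cM) * (Gi.map cM))ᵀ * J.map m * (G * Gi) := by
          rw [Matrix.transpose_mul]; simp only [Matrix.mul_assoc]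
      _ = J.map m := by rw [h1, hGGi, Matrix.transpose_one, Matrix.one_mul, Matrix.mul_one]
  -- the coercion of the conjugated element
  have hval : ((archGL L g * x * (archGL L g)⁻¹ : GL (Fin 2) (mixedEmbedding.mixedSpace L)) :
      Matrix (Fin 2) (Fin 2) (mixedEmbedding.mixedSpace L)) = G * X * Gi := by
    rw [← map_inv, Units.val_mul, Units.val_mul, val_archGL, val_archGL]
  rw [hval, Matrix.map_mul, Matrix.map_mul, Matrix.transpose_mul, Matrix.transpose_mul]
  calc (Gi.map cM)ᵀ * ((X.map cM)ᵀ * (G.map cM)ᵀ) * J.map m * (G * X * Gi)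
      = (Gi.map cM)ᵀ * ((X.map cM)ᵀ * ((G.map cM)ᵀ * J.map m * G) * X) * Gi := by simp only [Matrix.mul_assoc]
    _ = (Gi.map cM)ᵀ * J'.map m * Gi := by rw [hcong, hx]
    _ = J.map m := hcong'

/-- **`g · diag(u₁,u₂) · g⁻¹ ∈ U(diag h)(L⁺ ⊗ ℝ)`** for a rational isometry `g : (L², diag h') ⥲ (L², diag h)`: the (34) torus element. -/
def archConjDiag (g : GL (Fin 2) L) (h h' : Fin 2 → L)
    (hg : ((g : Matrix (Fin 2) (Fin 2) L).map (Literature.AlgebraicGeometry.ShimuraVarieties.conjRingHomK L))ᵀ * diagonal h * (g : Matrix (Fin 2) (Fin 2) L) = diagonal h')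
    (u : SeesawArchTorus L) :
    ↥(UnitaryGroup.arch (↥(maximalRealSubfield L)) L (IsCMField.complexConj L) 2 (diagonal h)) :=
  ⟨archGL L g * archDiagGL L u * (archGL L g)⁻¹, conj_mem_arch_of_congr L g _ _ hg (archDiagGL_mem_arch L h' u)⟩

/-- (Ported verbatim from the HodgeCMPerL package; no docstring in the source.) -/
@[simp] theorem coe_archConjDiag (g : GL (Fin 2) L) (h h' : Fin 2 → L)
    (hg : ((g : Matrix (Fin 2) (Fin 2) L).map (Literature.AlgebraicGeometry.ShimuraVarieties.conjRingHomK L))ᵀ * diagonal h * (g : Matrix (Fin 2) (Fin 2) L) = diagonal h')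
    (u : SeesawArchTorus L) :
    ((archConjDiag L g h h' hg u : ↥(UnitaryGroup.arch (↥(maximalRealSubfield L)) L (IsCMField.complexConj L) 2 (diagonal h))) :
      GL (Fin 2) (mixedEmbedding.mixedSpace L)) = archGL L g * archDiagGL L u * (archGL L g)⁻¹ := rfl

/-- **`g_𝔸 · diag((u₁,1),(u₂,1)) · g_𝔸⁻¹ = (g diag(u₁,u₂) g⁻¹, 1)` in `GL₂(𝔸_L)`** (the finite part of the torus element is `1`). -/
theorem toAdeleGL_mul_toGL_mul_inv (g : GL (Fin 2) L) (u : SeesawArchTorus L) :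
    Adelic.toAdeleGL L g * toGL L (SeesawArchTorus.toAdeles L u) * (Adelic.toAdeleGL L g)⁻¹ =
      GLn.ofInfinite 2 L (archGL L g * archDiagGL L u * (archGL L g)⁻¹) := by
  rw [← map_inv, ← map_inv, map_mul, map_mul, ofInfinite_archDiagGL]
  apply Units.ext
  rw [Units.val_mul, Units.val_mul, Units.val_mul, Units.val_mul]
  refine matrix_adele_ext L 2 ?_ ?_
  · rw [Matrix.map_mul, Matrix.map_mul, Matrix.map_mul, Matrix.map_mul, map_fst_toAdeleGL, map_fst_toAdeleGL,
      map_fst_ofInfinite, map_fst_ofInfinite]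
  · rw [Matrix.map_mul, Matrix.map_mul, Matrix.map_mul, Matrix.map_mul, map_snd_ofInfinite, map_snd_ofInfinite,
      map_snd_toGL_toAdeles, Matrix.mul_one, Matrix.one_mul, Matrix.mul_one, ← Matrix.map_mul, ← Units.val_mul,
      ← map_mul, mul_inv_cancel, map_one, Units.val_one, Matrix.map_one _ (map_zero _) (map_one _)]

end ArchTorus

/-! ## §3 (J-T34), adelic half, at a seesaw datum -/

section Seesaw

variable {L : CMField} (D : StubTree.SeesawDatum L)

/-- **(J-T34), adelic half**: `cmAdelicEquiv (jT₃₄ (ιc u)) = archToAdelic (g diag(u₁,u₂) g⁻¹)`, `g = D.isoGL`. -/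
theorem cmAdelicEquiv_jT₃₄_toAdeles (u : SeesawArchTorus (L : Type)) :
    cmAdelicEquiv (L : Type) 2 D.gramW (D.jT₃₄ (SeesawArchTorus.toAdeles (L : Type) u)) =
      archToAdelic (↥(maximalRealSubfield (L : Type))) (L : Type) (IsCMField.complexConj L) 2 D.gramW
        (archConjDiag (L : Type) D.isoGL ![D.a 0, D.a 1] ![D.a 2, D.a 3] D.isoGL_spec u) := by
  apply Subtype.ext
  exact (StubTree.SeesawDatum.coe_jT₃₄_apply D (SeesawArchTorus.toAdeles (L : Type) u)).trans
    (toAdeleGL_mul_toGL_mul_inv (L : Type) D.isoGL u)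

/-- **(J-T12), adelic half, at a seesaw datum**: `cmAdelicEquiv (jT₁₂ (ιc u)) = archToAdelic (diag(u₁,u₂))`. -/
theorem cmAdelicEquiv_jT₁₂_toAdeles (u : SeesawArchTorus (L : Type)) :
    cmAdelicEquiv (L : Type) 2 D.gramW (D.jT₁₂ (SeesawArchTorus.toAdeles (L : Type) u)) =
      archToAdelic (↥(maximalRealSubfield (L : Type))) (L : Type) (IsCMField.complexConj L) 2 D.gramW
        (archDiag (L : Type) ![D.a 0, D.a 1] u) :=
  cmAdelicEquiv_jT_toAdeles (L : Type) _ u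

end Seesaw

end HodgeCM.Model.HypCensus

end
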